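import Summits.QuantumFields.YangMills.Theorems.LocalInsertionSublevelDoublingDefs
import Summits.QuantumFields.YangMills.Theorems.LangevinControlUVFemtoCurvatureTwoPointCStubKoszulH1
import Literature.MathematicalPhysics.QuantumFieldTheory.ConstructiveQFTWave0Proofs
import HarnessLib

/-!
# Sublevel doubling of Wilson's action on `(ℤ/L)^d`, every `d` — the Koszul structure at a flat configuration

Crux `HistoryTailL` (stmt-QuantumFields-19936), level-0 lane (T4) «uniform doubling», row (T4-SUB), file 2: the `{d : ℕ}`-generic port
(literal `4 ↦ d`, proofs verbatim) of `Theorems/LangevinControlUVFemtoCurvatureTwoPointCDoublingKoszul.lean` (route `LangevinControlUV`,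
crux `FemtoCurvatureTwoPointC`, line `Sketch` v7, file P1). At a FLAT configuration `τ` (all plaquette holonomies `1`) the transports
`S_i` of `𝔤`-valued site functions (`…SublevelDoublingDefs`) are norm preserving and COMMUTE; hence (landed, `k`-generic
`stub_koszulH1`) every 1-form `A` with vanishing linearised curvature (`dOne τ A i j = 0` for all `i, j`) is an infinitesimal gauge
transform plus a constant form, `A = d⁰m + C`, `C ∈ constForms τ`; constant forms are curvature-free and orthogonal to the
infinitesimal gauge orbit `range d⁰` (so `constForms ≤ slice`); and on the massive directions `massive τ = slice τ ⊓ constFormsᗮ` the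
linearised curvature is bounded below: `λ² ‖B‖² ≤ Σ_{i,j} ‖dOne τ B i j‖²` with `λ > 0`. Rung R3 of the YM ladder (continuum SU(2)
YM₃ on T³) — not d = 4-specific any more, not infinite volume, not a mass gap, not Clay. Everything here is proved; no definitions.
-/

set_option autoImplicit false

noncomputable section

open scoped Matrix Matrix.Norms.Frobenius InnerProductSpace
open Literature.MathematicalPhysics.QuantumLattice Literature.MathematicalPhysics.QuantumFieldTheory
open Summit.QuantumFields.YangMills.Theorems.FreeEnergyLogCoefficient
open Summit.QuantumFields.YangMills.Theorems.FemtoCurvatureTwoPointC (stub_koszulH1)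
open Summit.QuantumFields.YangMills.Theorems.FemtoCurvatureTwoPointC.Doubling (Fib adFib lieIso_adFib adFib_mul adFib_one
  adFib_inv_apply adFib_apply_inv inner_adFib)

namespace Summit.QuantumFields.YangMills.Theorems.LocalInsertion.SublevelDoubling

variable {G : Type} [Group G] [TopologicalSpace G] [CompactSpace G] (r : LatticeRep G) {d L : ℕ}

/-! ### Transports: isometry and commutation -/

omit [TopologicalSpace G] [CompactSpace G] in
/-- `x ↦ x + e_i` is a bijection of the sites. -/
theorem shift_bijective (i : Fin d) : Function.Bijective (fun x : Site d L => x.shift i) :=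
  (Equiv.addRight (Pi.single i (1 : ZMod L) : Site d L)).bijective

/-- **Transports are norm preserving** (`Ad` is an isometry of the fibre and `x ↦ x + e_i` permutes the sites). -/
theorem norm_transport [NeZero L] (τ : GaugeConfig d L G) (i : Fin d) (f : SiteFun r d L) :
    ‖transport r τ i f‖ = ‖f‖ := by
  have h : ‖transport r τ i f‖ ^ 2 = ‖f‖ ^ 2 := by
    rw [PiLp.norm_sq_eq_of_L2, PiLp.norm_sq_eq_of_L2]
    simp only [transport_apply, LinearIsometry.norm_map]
    exact Function.Bijective.sum_comp (shift_bijective i) (fun y => ‖f y‖ ^ 2)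
  exact (sq_eq_sq₀ (norm_nonneg _) (norm_nonneg _)).1 h

omit [TopologicalSpace G] [CompactSpace G] in
/-- Flatness in product form: `τ(x,i) τ(x+e_i,j) = τ(x,j) τ(x+e_j,i)`. -/
theorem flat_mul_eq {τ : GaugeConfig d L G} (hτ : ∀ (x : Site d L) (i j : Fin d), plaquetteHolonomy τ x i j = 1)
    (x : Site d L) (i j : Fin d) : τ (x, i) * τ (x.shift i, j) = τ (x, j) * τ (x.shift j, i) := by
  have h := hτ x i j
  unfold plaquetteHolonomy at h
  have h2 : τ (x, i) * τ (x.shift i, j) * (τ (x.shift j, i))⁻¹ * (τ (x, j))⁻¹ * (τ (x, j) * τ (x.shift j, i)) =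
      τ (x, j) * τ (x.shift j, i) := by rw [h, one_mul]
  simpa [mul_assoc] using h2

/-- **Transports commute at a flat configuration.** -/
theorem transport_comm {τ : GaugeConfig d L G} (hτ : ∀ (x : Site d L) (i j : Fin d), plaquetteHolonomy τ x i j = 1)
    (i j : Fin d) (f : SiteFun r d L) :
    transport r τ i (transport r τ j f) = transport r τ j (transport r τ i f) := by
  refine PiLp.ext fun x => ?_
  simp only [transport_apply, ← adFib_mul, flat_mul_eq hτ x i j, WilsonRP.shift_comm x i j]

/-! ### Cocycles are gauge plus constant (from `stub_koszulH1`) -/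

omit [CompactSpace G] in
/-- The constant form with components `c i`. -/
theorem comp_toLp_eq (c : Fin d → SiteFun r d L) (i : Fin d) :
    comp r (WithLp.toLp 2 fun e : Edge d L => c e.2 e.1) i = c i := by
  ext x : 1
  simp

/-- **Koszul `H¹` at a flat `τ`**: a 1-form with vanishing linearised curvature is an infinitesimal gauge transform plus a
constant form, `A = d⁰m + C` with `C ∈ constForms τ`. -/
theorem exists_eq_dZero_add_const [NeZero L] {τ : GaugeConfig d L G}
    (hτ : ∀ (x : Site d L) (i j : Fin d), plaquetteHolonomy τ x i j = 1) (A : OneForm r d L)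
    (hA : ∀ i j : Fin d, dOne r τ A i j = 0) :
    ∃ (m : SiteFun r d L) (C : OneForm r d L), C ∈ constForms r τ ∧ A = dZero r τ m + C := by
  have hcoc : ∀ i j : Fin d, transport r τ i (comp r A j) - comp r A j = transport r τ j (comp r A i) - comp r A i :=
    fun i j => sub_eq_zero.1 (hA i j)
  obtain ⟨m, c, hc, hX⟩ := stub_koszulH1 (SiteFun r d L) d (transport r τ) (norm_transport r τ)
    (transport_comm r hτ) (comp r A) hcoc
  refine ⟨-m, WithLp.toLp 2 fun e => c e.2 e.1, ?_, ?_⟩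
  · rw [mem_constForms_iff]
    intro i
    rw [comp_toLp_eq, mem_zeroModes_iff]
    exact fun j => hc j i
  · refine PiLp.ext fun e => ?_
    obtain ⟨x, i⟩ := e
    have h := congrArg (fun f : SiteFun r d L => f x) (hX i)
    simp only [comp_apply, PiLp.add_apply, PiLp.sub_apply, transport_apply] at h
    simp only [PiLp.add_apply, dZero_apply, PiLp.neg_apply, map_neg]
    rw [h]; abel

/-! ### Constant forms: curvature-free and orthogonal to the gauge orbit -/

/-- Components of a constant form are zero modes, pointwise: `Ad r(τ(x,i)) c(x+e_i, j) = c(x, j)`. -/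
theorem adFib_apply_of_mem_constForms {τ : GaugeConfig d L G} {C : OneForm r d L} (hC : C ∈ constForms r τ)
    (x : Site d L) (i j : Fin d) : adFib r (τ (x, i)) (C (x.shift i, j)) = C (x, j) := by
  have h := (mem_zeroModes_iff r τ _).1 ((mem_constForms_iff r τ C).1 hC j) i
  have hx := congrArg (fun f : SiteFun r d L => f x) h
  simpa using hx

/-- **Constant forms are curvature-free**: `dOne τ C i j = 0` for `C ∈ constForms τ`. -/
theorem dOne_of_mem_constForms {τ : GaugeConfig d L G} {C : OneForm r d L} (hC : C ∈ constForms r τ) (i j : Fin d) :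
    dOne r τ C i j = 0 := by
  refine PiLp.ext fun x => ?_
  simp [dOne_apply, adFib_apply_of_mem_constForms r hC]

/-- **Gauge directions are curvature-free at a flat `τ`**: `dOne τ (d⁰η) i j = 0` (`d¹ ∘ d⁰ = 0`). -/
theorem dOne_dZero {τ : GaugeConfig d L G} (hτ : ∀ (x : Site d L) (i j : Fin d), plaquetteHolonomy τ x i j = 1)
    (η : SiteFun r d L) (i j : Fin d) : dOne r τ (dZero r τ η) i j = 0 := by
  refine PiLp.ext fun x => ?_
  rw [dOne_apply]
  simp only [dZero_apply, map_sub, ← adFib_mul, flat_mul_eq hτ x i j, WilsonRP.shift_comm x i j, PiLp.zero_apply]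
  abel

/-- **Constant forms are orthogonal to the infinitesimal gauge orbit**: `⟪d⁰η, C⟫ = 0` for `C ∈ constForms τ`. -/
theorem inner_dZero_of_mem_constForms [NeZero L] {τ : GaugeConfig d L G} {C : OneForm r d L} (hC : C ∈ constForms r τ)
    (η : SiteFun r d L) : ⟪dZero r τ η, C⟫_ℝ = 0 := by
  rw [PiLp.inner_apply]
  have hterm : ∀ e : Edge d L,
      ⟪dZero r τ η e, C e⟫_ℝ = ⟪η e.1, C e⟫_ℝ - ⟪adFib r (τ e) (η (e.1.shift e.2)), C e⟫_ℝ := fun e => by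
    rw [show dZero r τ η e = η e.1 - adFib r (τ e) (η (e.1.shift e.2)) from rfl, inner_sub_left]
  simp only [hterm]
  rw [Finset.sum_sub_distrib, sub_eq_zero]
  -- both sides equal `Σ_{x,i} ⟪η x, C(x,i)⟫`
  rw [← Finset.univ_product_univ, Finset.sum_product, Finset.sum_product]
  rw [Finset.sum_comm]
  conv_rhs => rw [Finset.sum_comm]
  refine Finset.sum_congr rfl fun i _ => ?_
  have hre : ∀ x : Site d L, ⟪adFib r (τ (x, i)) (η (x.shift i)), C (x, i)⟫_ℝ = ⟪η (x.shift i), C (x.shift i, i)⟫_ℝ := by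
    intro x
    rw [← adFib_apply_of_mem_constForms r hC x i i, inner_adFib]
  simp only [hre]
  exact (Function.Bijective.sum_comp (shift_bijective i) (fun y => ⟪η y, C (y, i)⟫_ℝ)).symm

/-- **`constForms τ ≤ slice τ`.** -/
theorem constForms_le_slice [NeZero L] (τ : GaugeConfig d L G) : constForms r τ ≤ slice r τ := by
  intro C hC
  rw [slice, Submodule.mem_orthogonal]
  rintro _ ⟨η, rfl⟩
  exact inner_dZero_of_mem_constForms r hC η

/-! ### The linearised curvature is bounded below on the massive directions -/

/-- The linearised curvature as one linear map `A ↦ (i, j) ↦ dOne τ A i j`. -/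
theorem dOneₗ_pi_apply (τ : GaugeConfig d L G) (A : OneForm r d L) (i j : Fin d) :
    (LinearMap.pi fun i : Fin d => LinearMap.pi fun j : Fin d => dOneₗ r τ i j) A i j = dOne r τ A i j := rfl

/-- **Injectivity on the massive directions**: a massive 1-form with vanishing linearised curvature vanishes. -/
theorem eq_zero_of_mem_massive [NeZero L] {τ : GaugeConfig d L G}
    (hτ : ∀ (x : Site d L) (i j : Fin d), plaquetteHolonomy τ x i j = 1) {B : OneForm r d L} (hB : B ∈ massive r τ)
    (h0 : ∀ i j : Fin d, dOne r τ B i j = 0) : B = 0 := by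
  obtain ⟨m, C, hC, hBe⟩ := exists_eq_dZero_add_const r hτ B h0
  obtain ⟨hBs, hBc⟩ := Submodule.mem_inf.1 hB
  have h1 : ⟪dZero r τ m, B⟫_ℝ = 0 := by
    rw [slice, Submodule.mem_orthogonal] at hBs
    exact hBs _ ⟨m, rfl⟩
  have h2 : ⟪C, B⟫_ℝ = 0 := by
    rw [Submodule.mem_orthogonal] at hBc
    exact hBc C hC
  have h3 : ⟪B, B⟫_ℝ = 0 := by
    calc ⟪B, B⟫_ℝ = ⟪dZero r τ m + C, B⟫_ℝ := by rw [← hBe]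
      _ = 0 := by rw [inner_add_left, h1, h2, add_zero]
  exact inner_self_eq_zero.1 h3

set_option maxHeartbeats 400000 in -- finite-dimensional bookkeeping (`LinearMap.pi`/`nlinarith`); > 100k heartbeats
/-- **Lower bound for the linearised curvature on the massive directions**: there is `λ > 0` with
`λ² ‖B‖² ≤ Σ_{i,j} ‖dOne τ B i j‖²` for every `B ∈ massive τ`. -/
theorem exists_dOne_lower_bound [NeZero L] {τ : GaugeConfig d L G}
    (hτ : ∀ (x : Site d L) (i j : Fin d), plaquetteHolonomy τ x i j = 1) :
    ∃ lam : ℝ, 0 < lam ∧ ∀ B ∈ massive r τ, lam ^ 2 * ‖B‖ ^ 2 ≤ ∑ i : Fin d, ∑ j : Fin d, ‖dOne r τ B i j‖ ^ 2 := by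
  -- the restriction of the curvature map to `massive τ`
  set Φ : OneForm r d L →ₗ[ℝ] (Fin d → Fin d → SiteFun r d L) :=
    LinearMap.pi fun i : Fin d => LinearMap.pi fun j : Fin d => dOneₗ r τ i j with hΦ
  set Ψ : massive r τ →ₗ[ℝ] (Fin d → Fin d → SiteFun r d L) := Φ.comp (massive r τ).subtype with hΨ
  have hker : LinearMap.ker Ψ = ⊥ := by
    rw [LinearMap.ker_eq_bot']
    intro B hB0
    have h0 : ∀ i j, dOne r τ (B : OneForm r d L) i j = 0 := fun i j => by
      have := congrFun (congrFun hB0 i) j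
      simpa [hΨ, hΦ] using this
    exact Subtype.ext (eq_zero_of_mem_massive r hτ B.2 h0)
  obtain ⟨K, hK0, hK⟩ := Ψ.exists_antilipschitzWith hker
  have hKpos : (0 : ℝ) < K := by exact_mod_cast hK0
  refine ⟨(K : ℝ)⁻¹, by positivity, fun B hB => ?_⟩
  have hle : ‖B‖ ≤ K * ‖Ψ ⟨B, hB⟩‖ := by
    have := hK.le_mul_dist ⟨B, hB⟩ 0
    simpa [dist_eq_norm] using this
  -- `‖Ψ B‖` is a sup norm: bounded by the square root of the sum of squares
  set T : ℝ := ∑ i : Fin d, ∑ j : Fin d, ‖dOne r τ B i j‖ ^ 2 with hT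
  have hT0 : 0 ≤ T := Finset.sum_nonneg fun _ _ => Finset.sum_nonneg fun _ _ => sq_nonneg _
  have hcomp : ∀ i j, Ψ ⟨B, hB⟩ i j = dOne r τ B i j := fun i j => rfl
  have hsqrt : ‖Ψ ⟨B, hB⟩‖ ≤ Real.sqrt T := by
    refine (pi_norm_le_iff_of_nonneg (Real.sqrt_nonneg T)).2 fun i => ?_
    refine (pi_norm_le_iff_of_nonneg (Real.sqrt_nonneg T)).2 fun j => ?_
    rw [hcomp]
    refine Real.le_sqrt_of_sq_le ?_
    have h1 : ‖dOne r τ B i j‖ ^ 2 ≤ ∑ j' : Fin d, ‖dOne r τ B i j'‖ ^ 2 :=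
      Finset.single_le_sum (f := fun j' => ‖dOne r τ B i j'‖ ^ 2) (fun _ _ => sq_nonneg _) (Finset.mem_univ j)
    exact h1.trans (Finset.single_le_sum (f := fun i' => ∑ j' : Fin d, ‖dOne r τ B i' j'‖ ^ 2)
      (fun _ _ => Finset.sum_nonneg fun _ _ => sq_nonneg _) (Finset.mem_univ i))
  have hsup : ‖Ψ ⟨B, hB⟩‖ ^ 2 ≤ T := by
    have h := pow_le_pow_left₀ (norm_nonneg _) hsqrt 2
    rwa [Real.sq_sqrt hT0] at h
  have hdiv : (K : ℝ)⁻¹ * ‖B‖ ≤ ‖Ψ ⟨B, hB⟩‖ := by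
    rw [inv_mul_le_iff₀ hKpos]; exact hle
  calc ((K : ℝ)⁻¹) ^ 2 * ‖B‖ ^ 2 = ((K : ℝ)⁻¹ * ‖B‖) ^ 2 := by ring
    _ ≤ ‖Ψ ⟨B, hB⟩‖ ^ 2 := pow_le_pow_left₀ (by positivity) hdiv 2
    _ ≤ T := hsup

end Summit.QuantumFields.YangMills.Theorems.LocalInsertion.SublevelDoubling

end
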